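import Literature.NumberTheory.Automorphic.UnitaryGroupTruncatedKernelHighCusp
import Literature.NumberTheory.Automorphic.UnitaryGroupTruncatedKernelMeasurable
import Literature.NumberTheory.Automorphic.UnitaryGroupKernelOffBorelVanishing
import Literature.NumberTheory.Automorphic.UnitaryGroupKernelFiniteSum
import HarnessLib

/-!
# High in the cusp Arthur's truncated kernel on `U(3)` is a fundamental-domain average of
# oscillations: `k^T(g) = ν(𝓕)⁻¹ ∫_𝓕 Σ_{β ∈ R(g)} [f(g⁻¹βg) − f(g⁻¹βug)] dν(u)`, and the cell bound
# `‖k^T(g)‖ ≤ #R(g) · ε`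

Topic `NumberTheory/Automorphic`; namespace `Literature.NumberTheory.Automorphic.UnitaryGroup`.
Proof file: theorems only (no definition, no named fact, no instance, no `sorry`); imports = tree +
Mathlib. Setting: the quasi-split unitary group `U(J₃)` of the CM-type quadratic extension `E/F`
(`quasiSplit F E c 3`), `N(𝔸_F) = adelicUnipotent F E c 3`, `N(F) = rationalUnipotent F E c 3`,
`B(F) = arithmeticBorel F E c 3`; Arthur's truncated kernel `k^T = truncatedKernel ν 𝓕 T f`
(`UnitaryGroupArthurTruncatedKernel`, Rogawski (1990), §2.2 with `P₀ = B`, `Z = A_G = 1`).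

THE POINT. The integrability of `k^T` over `G(F)\G(𝔸_F)` (the named fact
`UnitaryGroup.TruncatedKernelIntegrable` of `UnitaryGroupArthurTruncatedTrace`, Rogawski (1990), §2.2
p. 13; Arthur (1978), Thm. 7.1; Gelbart–Jacquet / Gelbart (1975), §9.B for `GL₂`) rests on ONE
estimate high in the cusp: there `k^T(g) = K(g, g) − K_B(g, g)`
(★ `truncatedKernel_eq_kernel_sub_kernelBorel`, `1 ≤ T < H(g)`), only `β ∈ B(F)` contribute to
`K(g, g)` (★ `exists_kernel_eq_borelSum_of_lt_borelHeight`, `H(g) > c₀(f)`), and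
`K_B(g, g) = ν(𝓕)⁻¹ ∫_𝓕 Σ_{β ∈ B(F)} f(g⁻¹ β u g) dν(u)` (★ `kernelBorel_eq_smul_integral`, `rfl`).
Hence, with `R(g) ⊆ B(F)` any finite set carrying all the terms (one exists, uniformly in `u` ranging
over a compact set: §1),
  `k^T(g) = ν(𝓕)⁻¹ ∫_𝓕 Σ_{β ∈ R(g)} [f(g⁻¹ β g) − f(g⁻¹ β u g)] dν(u)`          (§3),
an average over the fundamental domain of OSCILLATIONS of `f` under the right translations
`g⁻¹ u g`, `u ∈ 𝓕` (`g⁻¹ β u g = (g⁻¹ β g)(g⁻¹ u g)`), whence **the cell bound**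
  `‖k^T(g)‖ ≤ #R(g) · ε`  as soon as  `‖f(x) − f(x · g⁻¹ u g)‖ ≤ ε` for all `x` and all `u ∈ 𝓕` (§4).
In Siegel coordinates `#R(g) ≲ δ_B(a)` (cell count in `N(𝔸_F)`, ★
`Literature.MeasureTheory.Group.card_mul_measure_le_of_smul_subset`) and `ε ≲ H(g)^{-1/2·…}`
(archimedean contraction of `N_∞` by `Ad(a⁻¹)`, right invariance at the finite places), which is one
power of the root better than the trivial bound and suffices for `∫ |k^T| < ∞` in `F`-rank one —
no Poisson summation is needed (Gelbart (1975), (9.44)–(9.46) obtains the decay of the same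
difference `Σ_{ν ∈ N_ℚ} f(y⁻¹μνy) − ∫ f` by Poisson summation). This file is the algebraic step; the
count and the oscillation estimate are separate bricks.

* §1 `finite_setOf_exists_conj_mem_of_isCompact` — for compact `C, Y ⊆ G(𝔸_F)` and any `x`, only
  finitely many `β ∈ B(F)` have `x⁻¹ β (y x) ∈ C` for some `y ∈ Y` (★
  `finite_setOf_mem_arithmeticSubgroup_of_isCompact` applied to the compact `C · (Y x)⁻¹`).
* §2 `borelSum_eq_finsetSum` — `Σ'_{β ∈ B(F)} f(x⁻¹ β z) = Σ_{β ∈ R} f(x⁻¹ β z)` for any finite `R`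
  off which the terms vanish.
* §3 `truncatedKernel_eq_smul_setIntegral_sub` (`k^T(g) = ν(𝓕)⁻¹ ∫_𝓕 [Σ_β f(g⁻¹βg) − Σ_β f(g⁻¹βug)]`),
  `truncatedKernel_eq_smul_setIntegral_finsetSum_sub` (the displayed identity), for a Haar measure
  `ν`, a fundamental domain `𝓕` of `N(F)` contained in a compact set, `f ∈ C_c(G(𝔸_F))`,
  `1 ≤ T < H(g)` and `K(g, g) = Σ_{β ∈ B(F)} f(g⁻¹ β g)`.
* §4 `norm_truncatedKernel_le_card_mul` (hypothesis on the cells `‖f(g⁻¹βg) − f(g⁻¹βug)‖ ≤ ε`),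
  `norm_truncatedKernel_le_card_mul_of_forall_conj` (hypothesis `‖f(x) − f(x · g⁻¹ug)‖ ≤ ε`).
* §5 `exists_finset_truncatedKernel` — the packaged form with the finite set of §1 for
  `C = tsupport f`, `Y = {1} ∪ 𝓕̄`.

## References

* J. D. Rogawski, *Automorphic Representations of Unitary Groups in Three Variables* (1990), §2.2
  (pp. 12–14) [Rogawski1990].
* S. Gelbart, *Automorphic forms on adele groups*, Ann. of Math. Studies 83 (1975), §9.B,
  (9.40)–(9.46) [Gelbart1975].
* J. Arthur, *A trace formula for reductive groups I*, Duke Math. J. 45 (1978), §7 (through the two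
  expositions above).
-/

set_option autoImplicit false

noncomputable section

open MeasureTheory Measure NumberField IsDedekindDomain Set
open scoped NNReal ENNReal Pointwise

namespace Literature.NumberTheory.Automorphic

namespace UnitaryGroup

variable {F E : Type} [Field F] [NumberField F] [Field E] [NumberField E] [Algebra F E]
  {c : E ≃ₐ[F] E}

/-! ## §1 Uniform finiteness of the relevant Borel elements -/

section General

variable {N : ℕ}

/-- **Only finitely many `β ∈ B(F)` have `x⁻¹ β (y x)` in a compact set `C` for some `y` in a compact
set `Y`**: the condition forces `x⁻¹ β ∈ C (Y x)⁻¹`, a compact set, and `G(F)` is discrete in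
`G(𝔸_F)` (★ `finite_setOf_mem_arithmeticSubgroup_of_isCompact`; Gelbart (1975), (9.20) «the sum is
actually finite»). [cite: Gelbart1975, (9.20)] -/
theorem finite_setOf_exists_conj_mem_of_isCompact {C : Set (quasiSplit F E c N).Adelic}
    (hC : IsCompact C) {Y : Set (quasiSplit F E c N).Adelic} (hY : IsCompact Y)
    (x : (quasiSplit F E c N).Adelic) :
    {β : arithmeticBorel F E c N | ∃ y ∈ Y,
      x⁻¹ * (((β : (quasiSplit F E c N).arithmeticSubgroup)) : (quasiSplit F E c N).Adelic) * (y * x)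
        ∈ C}.Finite := by
  have hY' : IsCompact ((fun y : (quasiSplit F E c N).Adelic => (y * x)⁻¹) '' Y) :=
    hY.image ((continuous_id.mul continuous_const).inv)
  have hC' : IsCompact (C * ((fun y : (quasiSplit F E c N).Adelic => (y * x)⁻¹) '' Y)) := hC.mul hY'
  have hfin := finite_setOf_mem_arithmeticSubgroup_of_isCompact hC' x 1
  have hsub : {β : arithmeticBorel F E c N | ∃ y ∈ Y,
      x⁻¹ * (((β : (quasiSplit F E c N).arithmeticSubgroup)) : (quasiSplit F E c N).Adelic) * (y * x)
        ∈ C} ⊆ (Subtype.val : arithmeticBorel F E c N → (quasiSplit F E c N).arithmeticSubgroup) ⁻¹'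
      {γ : (quasiSplit F E c N).arithmeticSubgroup |
        x⁻¹ * (γ : (quasiSplit F E c N).Adelic) * 1 ∈
          C * ((fun y : (quasiSplit F E c N).Adelic => (y * x)⁻¹) '' Y)} := by
    rintro β ⟨y, hy, hβ⟩
    refine ⟨x⁻¹ * (((β : (quasiSplit F E c N).arithmeticSubgroup)) : (quasiSplit F E c N).Adelic) *
      (y * x), hβ, (y * x)⁻¹, ⟨y, hy, rfl⟩, ?_⟩
    simp only [mul_one, mul_assoc, mul_inv_cancel]
  exact ((hfin.preimage (Subtype.val_injective.injOn)).subset hsub)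

/-- **`Σ'_{β ∈ B(F)} f(x⁻¹ β z)` is a finite sum over any finite `R ⊆ B(F)` off which its terms vanish.**
[cite: Rogawski1990, §2.2 (p. 13)] -/
theorem borelSum_eq_finsetSum {f : (quasiSplit F E c N).Adelic → ℂ} {x z : (quasiSplit F E c N).Adelic}
    (R : Finset (arithmeticBorel F E c N))
    (hR : ∀ β ∉ R,
      f (x⁻¹ * (((β : (quasiSplit F E c N).arithmeticSubgroup)) : (quasiSplit F E c N).Adelic) * z) = 0) :
    borelSum f x z = ∑ β ∈ R,
      f (x⁻¹ * (((β : (quasiSplit F E c N).arithmeticSubgroup)) : (quasiSplit F E c N).Adelic) * z) := by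
  rw [borelSum_def]
  exact tsum_eq_sum fun β hβ => hR β hβ

/-- `N(F)` is countable (a subgroup of the countable `G(F)`). [cite: Rogawski1990, §2.1 (p. 11)] -/
private theorem countable_rationalUnipotent : Countable (rationalUnipotent F E c N) := by
  have hinj : Function.Injective fun γ : rationalUnipotent F E c N =>
      (⟨((γ : adelicUnipotent F E c N) : (quasiSplit F E c N).Adelic), γ.2⟩ :
        (quasiSplit F E c N).arithmeticSubgroup) := by
    intro a a' h
    exact Subtype.ext (Subtype.ext (congrArg
      (fun z : (quasiSplit F E c N).arithmeticSubgroup => (z : (quasiSplit F E c N).Adelic)) h))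
  haveI : Countable (quasiSplit F E c N).arithmeticSubgroup := by
    haveI : Countable E := NumberField.countable' (K := E)
    haveI : Countable (Matrix (Fin N) (Fin N) E) := inferInstanceAs (Countable (Fin N → Fin N → E))
    haveI : Countable (GL (Fin N) E) := Units.val_injective.countable
    haveI : Countable (quasiSplit F E c N).Rational :=
      inferInstanceAs (Countable (rational F E c N ((StdForm.antidiagonal N).over E)))
    exact (Set.countable_range _).to_subtype
  exact hinj.countable

/-- **A fundamental domain of `N(F)` has non-zero Haar measure** (its countably many translates cover
`N(𝔸_F)`). [cite: Rogawski1990, §2.1 (p. 11)] -/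
theorem measure_ne_zero_of_isFundamentalDomain [MeasurableSpace (adelicUnipotent F E c N)]
    [BorelSpace (adelicUnipotent F E c N)] (ν : Measure (adelicUnipotent F E c N)) [ν.IsHaarMeasure]
    {𝓕 : Set (adelicUnipotent F E c N)} (h𝓕 : IsFundamentalDomain (rationalUnipotent F E c N) 𝓕 ν) :
    ν 𝓕 ≠ 0 := by
  haveI : Countable (rationalUnipotent F E c N) := countable_rationalUnipotent
  haveI : MeasurableConstSMul (rationalUnipotent F E c N) (adelicUnipotent F E c N) :=
    ⟨fun γ => (continuous_const.mul continuous_id).measurable⟩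
  haveI : SMulInvariantMeasure (rationalUnipotent F E c N) (adelicUnipotent F E c N) ν :=
    ⟨fun γ s _hs => by
      rw [show (fun x : adelicUnipotent F E c N => γ • x) ⁻¹' s =
          (fun x : adelicUnipotent F E c N => ((γ : adelicUnipotent F E c N)) * x) ⁻¹' s from rfl,
        measure_preimage_mul]⟩
  have hν : ν ≠ 0 := by
    intro h
    have h' := isOpen_univ.measure_ne_zero ν univ_nonempty
    rw [h] at h'
    exact h' rfl
  exact h𝓕.measure_ne_zero hν

end General

/-! ## §3 `k^T` high in the cusp as a fundamental-domain average -/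

/-- `𝔸_E` is Hausdorff (local copy of the standard argument). [cite: Rogawski1990, §2.1 (p. 11)] -/
private theorem t2Space_adeleRing_E₇ : T2Space (AdeleRing (𝓞 E) E) := by
  haveI : T2Space (FiniteAdeleRing (𝓞 E) E) := inferInstanceAs <| T2Space
    (RestrictedProduct (fun w : IsDedekindDomain.HeightOneSpectrum (𝓞 E) => w.adicCompletion E)
      (fun w => (w.adicCompletionIntegers E : Set (w.adicCompletion E))) Filter.cofinite)
  haveI : T2Space (InfiniteAdeleRing E) :=
    inferInstanceAs <| T2Space ((w : InfinitePlace E) → w.Completion)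
  exact inferInstanceAs <| T2Space (InfiniteAdeleRing E × FiniteAdeleRing (𝓞 E) E)

section Three

variable [MeasurableSpace (adelicUnipotent F E c 3)] [BorelSpace (adelicUnipotent F E c 3)]

/-- The `K_B`-integrand `u ↦ Σ_{β ∈ B(F)} f(g⁻¹ β u g)` is integrable on a fundamental domain contained
in a compact set (it is continuous, ★ `continuous_borelSum`, and Haar measure is finite on compacta).
[cite: Rogawski1990, §2.2 (p. 13)] -/
theorem integrableOn_borelSum_translate (ν : Measure (adelicUnipotent F E c 3)) [ν.IsHaarMeasure]
    {𝓕 U : Set (adelicUnipotent F E c 3)} (hU : IsCompact U) (h𝓕U : 𝓕 ⊆ U)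
    {f : (quasiSplit F E c 3).Adelic → ℂ} (hfc : Continuous f) (hf : HasCompactSupport f)
    (g : (quasiSplit F E c 3).Adelic) :
    IntegrableOn (fun u : adelicUnipotent F E c 3 =>
      borelSum f g ((u : (quasiSplit F E c 3).Adelic) * g)) 𝓕 ν := by
  haveI := t2Space_adeleRing_E₇ (E := E)
  haveI : T2Space (quasiSplit F E c 3).Adelic :=
    inferInstanceAs (T2Space (adelic F E c 3 ((StdForm.antidiagonal 3).over E)))
  have hcont : Continuous fun u : adelicUnipotent F E c 3 =>
      borelSum f g ((u : (quasiSplit F E c 3).Adelic) * g) := by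
    letI : MeasurableSpace (quasiSplit F E c 3).Adelic := borel _
    haveI : BorelSpace (quasiSplit F E c 3).Adelic := ⟨rfl⟩
    have h1 : Continuous fun u : adelicUnipotent F E c 3 =>
        (g, (u : (quasiSplit F E c 3).Adelic) * g) :=
      continuous_const.prodMk (continuous_subtype_val.mul continuous_const)
    have hF : Continuous ((fun p : (quasiSplit F E c 3).Adelic × (quasiSplit F E c 3).Adelic =>
        borelSum f p.1 p.2) ∘ fun u : adelicUnipotent F E c 3 =>
          (g, (u : (quasiSplit F E c 3).Adelic) * g)) :=
      Continuous.comp (continuous_borelSum hfc hf) h1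
    exact hF
  exact (hcont.continuousOn.integrableOn_compact hU).mono_set h𝓕U

/-- **`k^T(g) = ν(𝓕)⁻¹ ∫_𝓕 [Σ_{β ∈ B(F)} f(g⁻¹βg) − Σ_{β ∈ B(F)} f(g⁻¹βug)] dν(u)` high in the cusp.**
Hypotheses: `ν` a Haar measure on `N(𝔸_F)`, `𝓕` a fundamental domain of `N(F)` contained in a compact
set, `f ∈ C_c(G(𝔸_F))`, `1 ≤ T < H(g)` and `K(g, g) = Σ_{β ∈ B(F)} f(g⁻¹ β g)` (★
`exists_kernel_eq_borelSum_of_lt_borelHeight` supplies the latter for `H(g) > c₀(f)`).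
(Rogawski (1990), §2.2 p. 13: `k^T = K − K_P` on the part of the Siegel set above `T`; Gelbart (1975),
(9.44).) [cite: Rogawski1990, §2.2 (p. 13)] -/
theorem truncatedKernel_eq_smul_setIntegral_sub (ν : Measure (adelicUnipotent F E c 3))
    [ν.IsHaarMeasure] {𝓕 U : Set (adelicUnipotent F E c 3)}
    (h𝓕 : IsFundamentalDomain (rationalUnipotent F E c 3) 𝓕 ν) (hU : IsCompact U) (h𝓕U : 𝓕 ⊆ U)
    {f : (quasiSplit F E c 3).Adelic → ℂ} (hfc : Continuous f) (hf : HasCompactSupport f)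
    {T : ℝ≥0} (hT : 1 ≤ T) {g : (quasiSplit F E c 3).Adelic} (hg : T < borelHeight g)
    (hK : kernel f g g = borelSum f g g) :
    truncatedKernel ν 𝓕 T f g = ((ν 𝓕).toReal⁻¹ : ℝ) •
      ∫ u in 𝓕, (borelSum f g g - borelSum f g ((u : (quasiSplit F E c 3).Adelic) * g)) ∂ν := by
  have h0 : ν 𝓕 ≠ 0 := measure_ne_zero_of_isFundamentalDomain ν h𝓕
  have htop : ν 𝓕 ≠ ∞ := ((measure_mono h𝓕U).trans_lt hU.measure_lt_top).ne
  have hr : (ν 𝓕).toReal ≠ 0 := ENNReal.toReal_ne_zero.2 ⟨h0, htop⟩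
  have hc : IntegrableOn (fun _ : adelicUnipotent F E c 3 => borelSum f g g) 𝓕 ν :=
    integrableOn_const htop
  rw [truncatedKernel_eq_kernel_sub_kernelBorel ν h𝓕 f hT hg, hK, kernelBorel_eq_smul_integral,
    integral_sub hc (integrableOn_borelSum_translate ν hU h𝓕U hfc hf g), setIntegral_const, smul_sub]
  congr 1
  rw [measureReal_def, smul_smul, inv_mul_cancel₀ hr, one_smul]

/-- **THE DISPLAYED IDENTITY `k^T(g) = ν(𝓕)⁻¹ ∫_𝓕 Σ_{β ∈ R} [f(g⁻¹ β g) − f(g⁻¹ β u g)] dν(u)`** for any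
finite `R ⊆ B(F)` carrying all the terms `f(g⁻¹ β g)` and `f(g⁻¹ β u g)`, `u ∈ 𝓕` (§1 supplies one).
[cite: Rogawski1990, §2.2 (p. 13)] -/
theorem truncatedKernel_eq_smul_setIntegral_finsetSum_sub (ν : Measure (adelicUnipotent F E c 3))
    [ν.IsHaarMeasure] {𝓕 U : Set (adelicUnipotent F E c 3)}
    (h𝓕 : IsFundamentalDomain (rationalUnipotent F E c 3) 𝓕 ν) (hU : IsCompact U) (h𝓕U : 𝓕 ⊆ U)
    {f : (quasiSplit F E c 3).Adelic → ℂ} (hfc : Continuous f) (hf : HasCompactSupport f)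
    {T : ℝ≥0} (hT : 1 ≤ T) {g : (quasiSplit F E c 3).Adelic} (hg : T < borelHeight g)
    (hK : kernel f g g = borelSum f g g) (R : Finset (arithmeticBorel F E c 3))
    (hR₁ : ∀ β ∉ R,
      f (g⁻¹ * (((β : (quasiSplit F E c 3).arithmeticSubgroup)) : (quasiSplit F E c 3).Adelic) * g) = 0)
    (hR₂ : ∀ β ∉ R, ∀ u ∈ 𝓕,
      f (g⁻¹ * (((β : (quasiSplit F E c 3).arithmeticSubgroup)) : (quasiSplit F E c 3).Adelic) *
        ((u : (quasiSplit F E c 3).Adelic) * g)) = 0) :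
    truncatedKernel ν 𝓕 T f g = ((ν 𝓕).toReal⁻¹ : ℝ) • ∫ u in 𝓕, (∑ β ∈ R,
      (f (g⁻¹ * (((β : (quasiSplit F E c 3).arithmeticSubgroup)) : (quasiSplit F E c 3).Adelic) * g) -
       f (g⁻¹ * (((β : (quasiSplit F E c 3).arithmeticSubgroup)) : (quasiSplit F E c 3).Adelic) *
        ((u : (quasiSplit F E c 3).Adelic) * g)))) ∂ν := by
  rw [truncatedKernel_eq_smul_setIntegral_sub ν h𝓕 hU h𝓕U hfc hf hT hg hK]
  congr 1
  refine setIntegral_congr_fun₀ h𝓕.nullMeasurableSet fun u hu => ?_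
  rw [borelSum_eq_finsetSum R hR₁, borelSum_eq_finsetSum R (fun β hβ => hR₂ β hβ u hu),
    Finset.sum_sub_distrib]

/-! ## §4 The cell bound -/

/-- **THE CELL BOUND `‖k^T(g)‖ ≤ #R · ε`**: if every relevant term oscillates by at most `ε` over the
cells, `‖f(g⁻¹ β g) − f(g⁻¹ β u g)‖ ≤ ε` for `β ∈ R`, `u ∈ 𝓕`, then `‖k^T(g)‖ ≤ #R · ε` (same
hypotheses as the identity). [cite: Rogawski1990, §2.2 (p. 13)] -/
theorem norm_truncatedKernel_le_card_mul (ν : Measure (adelicUnipotent F E c 3))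
    [ν.IsHaarMeasure] {𝓕 U : Set (adelicUnipotent F E c 3)}
    (h𝓕 : IsFundamentalDomain (rationalUnipotent F E c 3) 𝓕 ν) (hU : IsCompact U) (h𝓕U : 𝓕 ⊆ U)
    {f : (quasiSplit F E c 3).Adelic → ℂ} (hfc : Continuous f) (hf : HasCompactSupport f)
    {T : ℝ≥0} (hT : 1 ≤ T) {g : (quasiSplit F E c 3).Adelic} (hg : T < borelHeight g)
    (hK : kernel f g g = borelSum f g g) (R : Finset (arithmeticBorel F E c 3))
    (hR₁ : ∀ β ∉ R,
      f (g⁻¹ * (((β : (quasiSplit F E c 3).arithmeticSubgroup)) : (quasiSplit F E c 3).Adelic) * g) = 0)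
    (hR₂ : ∀ β ∉ R, ∀ u ∈ 𝓕,
      f (g⁻¹ * (((β : (quasiSplit F E c 3).arithmeticSubgroup)) : (quasiSplit F E c 3).Adelic) *
        ((u : (quasiSplit F E c 3).Adelic) * g)) = 0)
    {ε : ℝ} (hosc : ∀ β ∈ R, ∀ u ∈ 𝓕,
      ‖f (g⁻¹ * (((β : (quasiSplit F E c 3).arithmeticSubgroup)) : (quasiSplit F E c 3).Adelic) * g) -
        f (g⁻¹ * (((β : (quasiSplit F E c 3).arithmeticSubgroup)) : (quasiSplit F E c 3).Adelic) *
          ((u : (quasiSplit F E c 3).Adelic) * g))‖ ≤ ε) :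
    ‖truncatedKernel ν 𝓕 T f g‖ ≤ R.card * ε := by
  have h0 : ν 𝓕 ≠ 0 := measure_ne_zero_of_isFundamentalDomain ν h𝓕
  have htop : ν 𝓕 ≠ ∞ := ((measure_mono h𝓕U).trans_lt hU.measure_lt_top).ne
  have hpos : 0 < (ν 𝓕).toReal := ENNReal.toReal_pos h0 htop
  rw [truncatedKernel_eq_smul_setIntegral_finsetSum_sub ν h𝓕 hU h𝓕U hfc hf hT hg hK R hR₁ hR₂,
    norm_smul, norm_inv, Real.norm_eq_abs, abs_of_pos hpos]
  have hbound : ∀ u ∈ 𝓕, ‖∑ β ∈ R,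
      (f (g⁻¹ * (((β : (quasiSplit F E c 3).arithmeticSubgroup)) : (quasiSplit F E c 3).Adelic) * g) -
       f (g⁻¹ * (((β : (quasiSplit F E c 3).arithmeticSubgroup)) : (quasiSplit F E c 3).Adelic) *
        ((u : (quasiSplit F E c 3).Adelic) * g)))‖ ≤ R.card * ε := by
    intro u hu
    calc _ ≤ ∑ β ∈ R, ‖f (g⁻¹ * (((β : (quasiSplit F E c 3).arithmeticSubgroup)) :
            (quasiSplit F E c 3).Adelic) * g) -
          f (g⁻¹ * (((β : (quasiSplit F E c 3).arithmeticSubgroup)) : (quasiSplit F E c 3).Adelic) *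
            ((u : (quasiSplit F E c 3).Adelic) * g))‖ := norm_sum_le _ _
      _ ≤ ∑ β ∈ R, ε := Finset.sum_le_sum fun β hβ => hosc β hβ u hu
      _ = R.card * ε := by rw [Finset.sum_const, nsmul_eq_mul]
  calc (ν 𝓕).toReal⁻¹ * ‖∫ u in 𝓕, (∑ β ∈ R,
        (f (g⁻¹ * (((β : (quasiSplit F E c 3).arithmeticSubgroup)) : (quasiSplit F E c 3).Adelic) * g) -
         f (g⁻¹ * (((β : (quasiSplit F E c 3).arithmeticSubgroup)) : (quasiSplit F E c 3).Adelic) *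
          ((u : (quasiSplit F E c 3).Adelic) * g)))) ∂ν‖
      ≤ (ν 𝓕).toReal⁻¹ * ((R.card * ε) * (ν 𝓕).toReal) := by
        refine mul_le_mul_of_nonneg_left ?_ (inv_nonneg.2 hpos.le)
        have h := norm_setIntegral_le_of_norm_le_const htop.lt_top hbound
        rwa [measureReal_def] at h
    _ = R.card * ε := by field_simp

/-- **THE CELL BOUND, right-translation form**: since `g⁻¹ β u g = (g⁻¹ β g)(g⁻¹ u g)`, a uniform bound
`‖f(x) − f(x · g⁻¹ u g)‖ ≤ ε` (`x ∈ G(𝔸_F)`, `u ∈ 𝓕`) — the right modulus of continuity of `f` on the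
conjugate `g⁻¹ 𝓕 g` of the fundamental domain, SMALL high in the cusp — gives `‖k^T(g)‖ ≤ #R · ε`.
[cite: Rogawski1990, §2.2 (p. 13)] -/
theorem norm_truncatedKernel_le_card_mul_of_forall_conj (ν : Measure (adelicUnipotent F E c 3))
    [ν.IsHaarMeasure] {𝓕 U : Set (adelicUnipotent F E c 3)}
    (h𝓕 : IsFundamentalDomain (rationalUnipotent F E c 3) 𝓕 ν) (hU : IsCompact U) (h𝓕U : 𝓕 ⊆ U)
    {f : (quasiSplit F E c 3).Adelic → ℂ} (hfc : Continuous f) (hf : HasCompactSupport f)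
    {T : ℝ≥0} (hT : 1 ≤ T) {g : (quasiSplit F E c 3).Adelic} (hg : T < borelHeight g)
    (hK : kernel f g g = borelSum f g g) (R : Finset (arithmeticBorel F E c 3))
    (hR₁ : ∀ β ∉ R,
      f (g⁻¹ * (((β : (quasiSplit F E c 3).arithmeticSubgroup)) : (quasiSplit F E c 3).Adelic) * g) = 0)
    (hR₂ : ∀ β ∉ R, ∀ u ∈ 𝓕,
      f (g⁻¹ * (((β : (quasiSplit F E c 3).arithmeticSubgroup)) : (quasiSplit F E c 3).Adelic) *
        ((u : (quasiSplit F E c 3).Adelic) * g)) = 0)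
    {ε : ℝ} (hω : ∀ x : (quasiSplit F E c 3).Adelic, ∀ u ∈ 𝓕,
      ‖f x - f (x * (g⁻¹ * (u : (quasiSplit F E c 3).Adelic) * g))‖ ≤ ε) :
    ‖truncatedKernel ν 𝓕 T f g‖ ≤ R.card * ε := by
  refine norm_truncatedKernel_le_card_mul ν h𝓕 hU h𝓕U hfc hf hT hg hK R hR₁ hR₂ fun β _ u hu => ?_
  have hmul : g⁻¹ * (((β : (quasiSplit F E c 3).arithmeticSubgroup)) : (quasiSplit F E c 3).Adelic) *
      ((u : (quasiSplit F E c 3).Adelic) * g) =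
      g⁻¹ * (((β : (quasiSplit F E c 3).arithmeticSubgroup)) : (quasiSplit F E c 3).Adelic) * g *
        (g⁻¹ * (u : (quasiSplit F E c 3).Adelic) * g) := by group
  rw [hmul]
  exact hω _ u hu

/-! ## §5 The packaged form -/

/-- **THE PACKAGED CELL BOUND.** For a Haar measure `ν` on `N(𝔸_F)`, a fundamental domain `𝓕` of
`N(F)` inside a compact `U`, `f ∈ C_c(U(J₃)(𝔸_F))`, `1 ≤ T`, and `g` with `T < H(g)` and
`K(g, g) = Σ_{β ∈ B(F)} f(g⁻¹βg)`: the set `R(g)` of `β ∈ B(F)` with `g⁻¹ β (y g) ∈ supp f` for some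
`y ∈ {1} ∪ U` is finite, `k^T(g) = ν(𝓕)⁻¹ ∫_𝓕 Σ_{β ∈ R(g)} [f(g⁻¹βg) − f(g⁻¹βug)] dν(u)`, and
`‖k^T(g)‖ ≤ #R(g) · ε` whenever `‖f(x) − f(x · g⁻¹ug)‖ ≤ ε` for all `x` and `u ∈ 𝓕`.
[cite: Rogawski1990, §2.2 (p. 13)] -/
theorem exists_finset_truncatedKernel (ν : Measure (adelicUnipotent F E c 3)) [ν.IsHaarMeasure]
    {𝓕 U : Set (adelicUnipotent F E c 3)} (h𝓕 : IsFundamentalDomain (rationalUnipotent F E c 3) 𝓕 ν)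
    (hU : IsCompact U) (h𝓕U : 𝓕 ⊆ U) {f : (quasiSplit F E c 3).Adelic → ℂ} (hfc : Continuous f)
    (hf : HasCompactSupport f) {T : ℝ≥0} (hT : 1 ≤ T) {g : (quasiSplit F E c 3).Adelic}
    (hg : T < borelHeight g) (hK : kernel f g g = borelSum f g g) :
    ∃ R : Finset (arithmeticBorel F E c 3),
      (∀ β ∈ R, ∃ y ∈ insert (1 : (quasiSplit F E c 3).Adelic)
          ((fun u : adelicUnipotent F E c 3 => (u : (quasiSplit F E c 3).Adelic)) '' U),
        g⁻¹ * (((β : (quasiSplit F E c 3).arithmeticSubgroup)) : (quasiSplit F E c 3).Adelic) * (y * g)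
          ∈ tsupport f) ∧
      truncatedKernel ν 𝓕 T f g = ((ν 𝓕).toReal⁻¹ : ℝ) • ∫ u in 𝓕, (∑ β ∈ R,
        (f (g⁻¹ * (((β : (quasiSplit F E c 3).arithmeticSubgroup)) : (quasiSplit F E c 3).Adelic) * g) -
         f (g⁻¹ * (((β : (quasiSplit F E c 3).arithmeticSubgroup)) : (quasiSplit F E c 3).Adelic) *
          ((u : (quasiSplit F E c 3).Adelic) * g)))) ∂ν ∧
      ∀ ε : ℝ, (∀ x : (quasiSplit F E c 3).Adelic, ∀ u ∈ 𝓕,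
        ‖f x - f (x * (g⁻¹ * (u : (quasiSplit F E c 3).Adelic) * g))‖ ≤ ε) →
        ‖truncatedKernel ν 𝓕 T f g‖ ≤ R.card * ε := by
  -- the compact set of right factors `Y = {1} ∪ U` and the finite set of §1 for `C = tsupport f`
  set Y : Set (quasiSplit F E c 3).Adelic := insert (1 : (quasiSplit F E c 3).Adelic)
    ((fun u : adelicUnipotent F E c 3 => (u : (quasiSplit F E c 3).Adelic)) '' U) with hY
  have hYc : IsCompact Y := (hU.image continuous_subtype_val).insert 1
  have hfin := finite_setOf_exists_conj_mem_of_isCompact hf hYc g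
  refine ⟨hfin.toFinset, fun β hβ => (hfin.mem_toFinset.1 hβ), ?_, ?_⟩
  · refine truncatedKernel_eq_smul_setIntegral_finsetSum_sub ν h𝓕 hU h𝓕U hfc hf hT hg hK _
      (fun β hβ => ?_) (fun β hβ u hu => ?_)
    · by_contra h
      exact hβ (hfin.mem_toFinset.2 ⟨1, mem_insert _ _, by
        rw [one_mul]; exact subset_tsupport _ (Function.mem_support.2 h)⟩)
    · by_contra h
      exact hβ (hfin.mem_toFinset.2 ⟨(u : (quasiSplit F E c 3).Adelic),
        mem_insert_of_mem _ ⟨u, h𝓕U hu, rfl⟩, subset_tsupport _ (Function.mem_support.2 h)⟩)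
  · intro ε hω
    refine norm_truncatedKernel_le_card_mul_of_forall_conj ν h𝓕 hU h𝓕U hfc hf hT hg hK _
      (fun β hβ => ?_) (fun β hβ u hu => ?_) hω
    · by_contra h
      exact hβ (hfin.mem_toFinset.2 ⟨1, mem_insert _ _, by
        rw [one_mul]; exact subset_tsupport _ (Function.mem_support.2 h)⟩)
    · by_contra h
      exact hβ (hfin.mem_toFinset.2 ⟨(u : (quasiSplit F E c 3).Adelic),
        mem_insert_of_mem _ ⟨u, h𝓕U hu, rfl⟩, subset_tsupport _ (Function.mem_support.2 h)⟩)

end Three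

end UnitaryGroup

end Literature.NumberTheory.Automorphic
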